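import Literature.Geometry.Lorentzian.TameFamilyOffCompact
import Summits.FinalStateConjecture.FinalStateConjecture.Theorems.PhotonSphereChannelsTameCensorshipShearInjImm

/-!
# Route PhotonSphereChannels · crux `TameCensorship` (stmt-FinalStateConjecture-17431) · line `Sketch`, skeleton v4 ·
# stub `stub_witnessOfGoodPath`: a good compactly supported path ⇒ a tame immersed injective witness

Helper file (`--supports stmt-FinalStateConjecture-17431`) of the reshaped line `Sketch` (lead c1, 2026-08-17); the third of
its three Lean-sized glue stubs. It composes the landed gauge shear `stub_shearInjImm` (p134394) with the collar
tameness lemma `InitialDataSet.isTameDataFamily_restrict_of_agree_off_compact_one` (Literature, `TameFamilyOffCompact`):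
a smooth admissible path through an admissible datum `d`, supported on a compact set, whose small members off `0` have a
gauge-invariant property `P`, becomes an injective, immersed family of admissible data through `d`, TAME on the (collared)
sole end of `d`, all of whose members off `0` have `P` — exactly the witness shape of
`InitialDataSet.IsTameChristodoulouGeneric … P 1`. No definition is introduced.

References: D. Christodoulou, CQG 16 (1999) A23, p. A24; M. Dafermos, I. Rodnianski, arXiv:0811.0354, App. B.2.3.
-/

set_option linter.dupNamespace false

open Literature.Geometry.Lorentzian
open scoped Manifold ContDiff Topology
open Filter Set Function

noncomputable section

namespace Summit.FinalStateConjecture.FinalStateConjecture.Theorems.PhotonSphereChannels.TameCensorshipUnwind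

/-- **Stub `stub_witnessOfGoodPath` of line `Sketch` (skeleton v4) for the crux `PhotonSphereChannels.TameCensorship`
(stmt-FinalStateConjecture-17431): a compactly supported admissible path of `P`-good small members through an admissible
datum yields a TAME, IMMERSED, INJECTIVE admissible witness curve through it with `P`-good members off `0`**, for every
property `P` invariant under re-indexing the datum by a diffeomorphism of `Σ`. The gauge shear `stub_shearInjImm`
(p134394: breathing re-indexing + radial squash) supplies a smooth, injective, immersed admissible family `F` with
`F 0 = d` and `P (F c)` for all `c ≠ 0`, agreeing member-wise off a compact set with a reparametrisation of the path;
since the path agrees with `d` off another compact set, `F` agrees with `F 0 = d` off the union, so it is tame on the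
collared sole end of `d` (`isTameDataFamily_restrict_of_agree_off_compact_one`: Dafermos–Rodnianski rates and
`wDist`-continuity are read far out, where nothing moves). [Christodoulou 1999, p. A24; Dafermos–Rodnianski
arXiv:0811.0354, App. B.2.3.] -/
theorem stub_witnessOfGoodPath :
    ∀ (X : Type) [TopologicalSpace X] [ChartedSpace E3 X] [IsManifold (𝓡 3) ∞ X] [T2Space X]
    [SecondCountableTopology X] [ConnectedSpace X] (P : InitialDataSet (𝓡 3) X → Prop), (∀ (D :
    InitialDataSet (𝓡 3) X) (Φ : X ≃ₜ X) (hΦ : ContMDiff (𝓡 3) (𝓡 3) (∞ + 1) Φ) (hΦ' : ∀ u,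
    Injective (mfderiv (𝓡 3) (𝓡 3) Φ u)), ContMDiff (𝓡 3) (𝓡 3) (∞ + 1) Φ.symm → (∀ u, Injective
    (mfderiv (𝓡 3) (𝓡 3) Φ.symm u)) → D ∈ admissibleVacuumData X → P D → P (D.comap Φ hΦ hΦ')) → ∀
    (d : InitialDataSet (𝓡 3) X) (G : EuclideanSpace ℝ (Fin 1) → InitialDataSet (𝓡 3) X),
    InitialDataSet.IsSmoothDataFamily 1 G → G 0 = d → d ∈ admissibleVacuumData X → (∀ c, G c ∈
    admissibleVacuumData X) → (∃ K : Set X, IsCompact K ∧ ∀ c, ∀ x ∉ K, (G c).h.inner x = d.h.inner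
    x ∧ (G c).k x = d.k x) → (∃ ε : ℝ, 0 < ε ∧ ∀ c, c ≠ 0 → ‖c‖ < ε → P (G c)) → ∃ (e : AFEnd X) (F
    : EuclideanSpace ℝ (Fin 1) → InitialDataSet (𝓡 3) X), InitialDataSet.IsTameDataFamily e 1 F ∧
    InitialDataSet.IsImmersedAtZero 1 F ∧ F 0 = d ∧ Injective F ∧ (∀ c, F c ∈ admissibleVacuumData
    X) ∧ ∀ c ≠ 0, P (F c) := by
  intro X _ _ _ _ _ _ P hP d G hG hG0 hd hadm hK hgood
  obtain ⟨K, hK, hagree⟩ := hK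
  obtain ⟨F, φ, K', -, -, hK', hFs, hinj, himm, hF0, hFadm, hFagree, hPF⟩ :=
    stub_shearInjImm X P hP G hG hadm hgood
  obtain ⟨-, e, M, hsole, hdecay⟩ := id hd
  have hF0d : F 0 = d := hF0.trans hG0
  have hSAF : e.IsStronglyAsymptoticallyFlatDR (F 0) M := by
    rw [hF0d]
    exact hdecay
  have hagree' : ∀ c, ∀ x ∉ K' ∪ K,
      (F c).h.inner x = (F 0).h.inner x ∧ (F c).k x = (F 0).k x := by
    intro c x hx
    rw [Set.mem_union, not_or] at hx
    obtain ⟨h1, h2⟩ := hFagree c x hx.1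
    obtain ⟨h3, h4⟩ := hagree (φ c) x hx.2
    rw [hF0d]
    exact ⟨h1.trans h3, h2.trans h4⟩
  exact ⟨_, F, InitialDataSet.isTameDataFamily_restrict_of_agree_off_compact_one hFs hsole hSAF
    (hK'.union hK) hagree' (lt_add_one e.R), himm, hF0d, hinj, hFadm, hPF⟩

end Summit.FinalStateConjecture.FinalStateConjecture.Theorems.PhotonSphereChannels.TameCensorshipUnwind

end
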